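import Mathlib
import HarnessLib
import Summits.Ventures.LatticeQCDFlow.Exactness.SUNSpectralKernelBookedBoxFlow
import Summits.Ventures.LatticeQCDFlow.Exactness.SpectralRecipeOffWalls

/-!
# The `SU(N)` spectral kernel AS SHIPPED: measurable data, recipe and equivariance only at simple spectra, box coordinates — exact for Haar with the booked density

HONEST FRAMING: exact (Metropolis-corrected) sampling algorithms for lattice gauge theory;
figures of merit are autocorrelation/cost numbers at stated couplings and volumes; no
continuum-physics claim.

Venture `LatticeQCDFlow` (cell pub-lqcd), topic `Exactness`; FANOUT row 10 (`eng-equiv`, engine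
`latflow.equiv` `spectral.spectral_kernel(N, cell='simplex')`; Boyda et al., PRD 103 (2021) 074504 §III.C,
App. B).  NEW WORK of the cell: the end of the chain.  `SUNSpectralKernelBookedBoxFlow.lean` proves
exactness for a kernel that follows the spectral recipe in EVERY diagonalization with an eigenvalue map
equivariant at EVERY unimodular spectrum; the shipped kernel diagonalizes, sorts the eigen-phases into the
canonical cell, applies the box flow and un-sorts — which follows the recipe and is equivariant only where
the sort is unambiguous, i.e. at SIMPLE spectra (off the alcove walls).  `SpectralRecipeOffWalls.lean`
shows the walls are irrelevant (Haar-null; wall-identity modifications).  This file composes the two: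
every hypothesis on `f`, `h`, `JD`, `J` is asked only at injective spectra / simple-spectrum matrices,
plus plain measurability of the shipped `f`, `h`, `J`.  Nothing continuous; nothing cited as a fact; no
number; no definition.

* `injective_circleExp_of_mem_alcove_sun` — alcove phases give injective spectra;
* **`hasJacobian_spectralKernel_sun_shipped`**.
-/

noncomputable section

namespace Summit.Ventures.LatticeQCDFlow.Exactness

open MeasureTheory Matrix Set Real Finset
open Literature.LinearAlgebra.Matrix
open Literature.MathematicalPhysics.QuantumFieldTheory (haarProbability)
open scoped ENNReal

variable {n : ℕ}

section Shipped

variable {E : (Fin n → ℝ) → specialDiagonalTorus (Fin (n + 1))}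
  (hE : ∀ θ (i : Fin (n + 1)), (((E θ : specialDiagonalTorus (Fin (n + 1))) : Matrix.specialUnitaryGroup (Fin (n + 1)) ℂ) :
    Matrix (Fin (n + 1)) (Fin (n + 1)) ℂ) i i = (Circle.exp ((Fin.snoc θ (-∑ k, θ k) : Fin (n + 1) → ℝ) i) : ℂ))
  {P : Equiv.Perm (Fin (n + 1)) → specialDiagonalTorus (Fin (n + 1)) → specialDiagonalTorus (Fin (n + 1))}
  (hP : ∀ σ t i, (((P σ t : specialDiagonalTorus (Fin (n + 1))) : Matrix.specialUnitaryGroup (Fin (n + 1)) ℂ) :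
    Matrix (Fin (n + 1)) (Fin (n + 1)) ℂ) i i =
      ((t : Matrix.specialUnitaryGroup (Fin (n + 1)) ℂ) : Matrix (Fin (n + 1)) (Fin (n + 1)) ℂ) (σ i) (σ i))
  {φ Z : (Fin n → ℝ) → (Fin n → ℝ)}
  (hφ : ∀ a i, φ a i = a i * ∏ j ∈ Finset.Iio i, (1 - a j))
  (hZ : ∀ ρ i, Z ρ i = -(2 * π / (n + 1)) * (∑ k : Fin n, ((n : ℝ) - k) * ρ k) + 2 * π * ∑ k ∈ Finset.Iio i, ρ k)

include hE in
/-- Alcove phases exponentiate to an injective (simple) spectrum. -/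
theorem injective_circleExp_of_mem_alcove_sun {θ : Fin n → ℝ}
    (hmono : StrictMono (Fin.snoc θ (-∑ k, θ k) : Fin (n + 1) → ℝ))
    (hlast : (Fin.snoc θ (-∑ k, θ k) : Fin (n + 1) → ℝ) (Fin.last n) < (Fin.snoc θ (-∑ k, θ k) : Fin (n + 1) → ℝ) 0 + 2 * π) :
    Function.Injective fun i : Fin (n + 1) => (Circle.exp ((Fin.snoc θ (-∑ k, θ k) : Fin (n + 1) → ℝ) i) : ℂ) := by
  intro i j hij
  by_contra hne
  refine angleChart_sun_regular hE hmono hlast i j hne ?_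
  rw [hE, hE]
  exact hij

include hE hP hφ hZ

/-- **The `SU(N)` spectral kernel as shipped is an exact transport of Haar with the booked density.**
Box flow `χ` on `B = (0,1)ⁿ` with `HasJacobian (Leb|_B) χ Jχ`, `χ(B) ⊆ B`; shipped eigenvalue map `f`
MEASURABLE, permutation-equivariant and unimodularity/unit-product preserving AT INJECTIVE unimodular
spectra, with `f(e^{ix(Zφa)}) = e^{ix(Zφ(χa))}` on `B`; shipped kernel `h` MEASURABLE, following the
spectral recipe of `f` in every unitary diagonalization WITH INJECTIVE SPECTRUM; spectral datum `JD`
measurable, symmetric at injective spectra, with the booked box-coordinate value on `B`; shipped density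
`J` MEASURABLE with `J W = JD d` in every unitary diagonalization with injective `d`.  Then
`HasJacobian (Haar SU(n+1)) h J`.  (What `f`, `h`, `J` do at repeated eigenvalues is irrelevant.) -/
theorem hasJacobian_spectralKernel_sun_shipped
    {f : (Fin (n + 1) → ℂ) → (Fin (n + 1) → ℂ)} (hfm : Measurable f)
    (hfperm : ∀ (σ : Equiv.Perm (Fin (n + 1))) (d : Fin (n + 1) → ℂ), (∀ i, ‖d i‖ = 1) → Function.Injective d →
      f (fun i => d (σ i)) = fun i => f d (σ i))
    {χ : (Fin n → ℝ) → (Fin n → ℝ)} {Jχ : (Fin n → ℝ) → ℝ≥0∞}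
    (hχ : HasJacobian ((volume : Measure (Fin n → ℝ)).restrict (Set.pi univ fun _ : Fin n => Ioo (0 : ℝ) 1)) χ Jχ)
    (hχbox : ∀ a ∈ Set.pi univ (fun _ : Fin n => Ioo (0 : ℝ) 1), χ a ∈ Set.pi univ fun _ : Fin n => Ioo (0 : ℝ) 1)
    (hfG : ∀ a ∈ Set.pi univ (fun _ : Fin n => Ioo (0 : ℝ) 1),
      f (fun i => (Circle.exp ((Fin.snoc (Z (φ a)) (-∑ k, Z (φ a) k) : Fin (n + 1) → ℝ) i) : ℂ)) =
        fun i => (Circle.exp ((Fin.snoc (Z (φ (χ a))) (-∑ k, Z (φ (χ a)) k) : Fin (n + 1) → ℝ) i) : ℂ))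
    {h : Matrix.specialUnitaryGroup (Fin (n + 1)) ℂ → Matrix.specialUnitaryGroup (Fin (n + 1)) ℂ} (hhm : Measurable h)
    (hagree : ∀ (Q : Matrix.specialUnitaryGroup (Fin (n + 1)) ℂ) (V : Matrix (Fin (n + 1)) (Fin (n + 1)) ℂ)
      (d : Fin (n + 1) → ℂ), V ∈ Matrix.unitaryGroup (Fin (n + 1)) ℂ → Function.Injective d →
        (Q : Matrix (Fin (n + 1)) (Fin (n + 1)) ℂ) = V * diagonal d * star V →
        ((h Q : Matrix.specialUnitaryGroup (Fin (n + 1)) ℂ) : Matrix (Fin (n + 1)) (Fin (n + 1)) ℂ) =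
          V * diagonal (f d) * star V)
    (hf1 : ∀ d : Fin (n + 1) → ℂ, (∀ i, ‖d i‖ = 1) → Function.Injective d → ∀ i, ‖f d i‖ = 1)
    (hfdet : ∀ d : Fin (n + 1) → ℂ, (∀ i, ‖d i‖ = 1) → Function.Injective d → ∏ i, d i = 1 → ∏ i, f d i = 1)
    {JD : (Fin (n + 1) → ℂ) → ℝ≥0∞} (hJDm : Measurable JD)
    (hJDperm : ∀ (σ : Equiv.Perm (Fin (n + 1))) (d : Fin (n + 1) → ℂ), Function.Injective d →
      JD (fun i => d (σ i)) = JD d)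
    (hJchart : ∀ a ∈ Set.pi univ (fun _ : Fin n => Ioo (0 : ℝ) 1),
      JD (fun i => (Circle.exp ((Fin.snoc (Z (φ a)) (-∑ k, Z (φ a) k) : Fin (n + 1) → ℝ) i) : ℂ)) *
          ENNReal.ofReal ((∏ i, ∏ k ∈ Finset.univ.erase i,
            ‖(Circle.exp ((Fin.snoc (Z (φ a)) (-∑ k, Z (φ a) k) : Fin (n + 1) → ℝ) i) : ℂ) -
              (Circle.exp ((Fin.snoc (Z (φ a)) (-∑ k, Z (φ a) k) : Fin (n + 1) → ℝ) k) : ℂ)‖) /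
                (Fintype.card (Fin (n + 1))).factorial) =
        (ENNReal.ofReal |∏ i : Fin n, ∏ j ∈ Finset.Iio i, (1 - (χ a) j)| * Jχ a /
            ENNReal.ofReal |∏ i : Fin n, ∏ j ∈ Finset.Iio i, (1 - a j)|) *
          ENNReal.ofReal ((∏ i, ∏ k ∈ Finset.univ.erase i,
            ‖(Circle.exp ((Fin.snoc (Z (φ (χ a))) (-∑ k, Z (φ (χ a)) k) : Fin (n + 1) → ℝ) i) : ℂ) -
              (Circle.exp ((Fin.snoc (Z (φ (χ a))) (-∑ k, Z (φ (χ a)) k) : Fin (n + 1) → ℝ) k) : ℂ)‖) /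
                (Fintype.card (Fin (n + 1))).factorial))
    {J : Matrix.specialUnitaryGroup (Fin (n + 1)) ℂ → ℝ≥0∞} (hJm : Measurable J)
    (hJspec : ∀ (W : Matrix.specialUnitaryGroup (Fin (n + 1)) ℂ) (V : Matrix (Fin (n + 1)) (Fin (n + 1)) ℂ) (d : Fin (n + 1) → ℂ),
      V ∈ Matrix.unitaryGroup (Fin (n + 1)) ℂ → Function.Injective d →
        (W : Matrix (Fin (n + 1)) (Fin (n + 1)) ℂ) = V * diagonal d * star V → J W = JD d) :
    HasJacobian (haarProbability (Matrix.specialUnitaryGroup (Fin (n + 1)) ℂ)) h J := by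
  classical
  -- wall-identity modifications
  obtain ⟨f', hf'm, hf'reg, hf'wall⟩ := exists_wallId_eigenvalueMap hfm
  obtain ⟨h', hh'm, hh'reg, hh'wall⟩ := exists_wallId_kernel hhm
  obtain ⟨JD', hJD'm, hJD'reg, hJD'wall⟩ := exists_wallId_datum hJDm
  have hSep : MeasurableSet {W : Matrix.specialUnitaryGroup (Fin (n + 1)) ℂ |
      (W : Matrix (Fin (n + 1)) (Fin (n + 1)) ℂ).charpoly.Separable} := by
    have h0 := Literature.MathematicalPhysics.QuantumFieldTheory.Balaban1983to89.HaarRegularElementsNull.measurableSet_specialUnitaryGroup_setOf_not_separable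
      (n := Fin (n + 1))
    have heq : {W : Matrix.specialUnitaryGroup (Fin (n + 1)) ℂ | (W : Matrix (Fin (n + 1)) (Fin (n + 1)) ℂ).charpoly.Separable} =
        {W : Matrix.specialUnitaryGroup (Fin (n + 1)) ℂ | ¬ (W : Matrix (Fin (n + 1)) (Fin (n + 1)) ℂ).charpoly.Separable}ᶜ := by
      ext W
      simp
    rw [heq]
    exact h0.compl
  set J' : Matrix.specialUnitaryGroup (Fin (n + 1)) ℂ → ℝ≥0∞ := fun W =>
    if (W : Matrix (Fin (n + 1)) (Fin (n + 1)) ℂ).charpoly.Separable then J W else 1 with hJ'def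
  have hJ'm : Measurable J' := Measurable.ite hSep hJm measurable_const
  have hJ'reg : ∀ W : Matrix.specialUnitaryGroup (Fin (n + 1)) ℂ,
      (W : Matrix (Fin (n + 1)) (Fin (n + 1)) ℂ).charpoly.Separable → J' W = J W := fun W hW => if_pos hW
  have hJ'wall : ∀ W : Matrix.specialUnitaryGroup (Fin (n + 1)) ℂ,
      ¬ (W : Matrix (Fin (n + 1)) (Fin (n + 1)) ℂ).charpoly.Separable → J' W = 1 := fun W hW => if_neg hW
  -- alcove spectra are injective
  have hinjB : ∀ a ∈ Set.pi univ (fun _ : Fin n => Ioo (0 : ℝ) 1),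
      Function.Injective fun i : Fin (n + 1) => (Circle.exp ((Fin.snoc (Z (φ a)) (-∑ k, Z (φ a) k) : Fin (n + 1) → ℝ) i) : ℂ) := by
    intro a ha
    have hA := gapChart_stickBreaking_mem_alcove_sun hφ hZ ha
    exact injective_circleExp_of_mem_alcove_sun hE hA.1 hA.2
  -- the everywhere hypotheses for the primed data
  have hfG' : ∀ a ∈ Set.pi univ (fun _ : Fin n => Ioo (0 : ℝ) 1),
      f' (fun i => (Circle.exp ((Fin.snoc (Z (φ a)) (-∑ k, Z (φ a) k) : Fin (n + 1) → ℝ) i) : ℂ)) =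
        fun i => (Circle.exp ((Fin.snoc (Z (φ (χ a))) (-∑ k, Z (φ (χ a)) k) : Fin (n + 1) → ℝ) i) : ℂ) := by
    intro a ha
    rw [hf'reg _ (hinjB a ha)]
    exact hfG a ha
  have hJchart' : ∀ a ∈ Set.pi univ (fun _ : Fin n => Ioo (0 : ℝ) 1),
      JD' (fun i => (Circle.exp ((Fin.snoc (Z (φ a)) (-∑ k, Z (φ a) k) : Fin (n + 1) → ℝ) i) : ℂ)) *
          ENNReal.ofReal ((∏ i, ∏ k ∈ Finset.univ.erase i,
            ‖(Circle.exp ((Fin.snoc (Z (φ a)) (-∑ k, Z (φ a) k) : Fin (n + 1) → ℝ) i) : ℂ) -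
              (Circle.exp ((Fin.snoc (Z (φ a)) (-∑ k, Z (φ a) k) : Fin (n + 1) → ℝ) k) : ℂ)‖) /
                (Fintype.card (Fin (n + 1))).factorial) =
        (ENNReal.ofReal |∏ i : Fin n, ∏ j ∈ Finset.Iio i, (1 - (χ a) j)| * Jχ a /
            ENNReal.ofReal |∏ i : Fin n, ∏ j ∈ Finset.Iio i, (1 - a j)|) *
          ENNReal.ofReal ((∏ i, ∏ k ∈ Finset.univ.erase i,
            ‖(Circle.exp ((Fin.snoc (Z (φ (χ a))) (-∑ k, Z (φ (χ a)) k) : Fin (n + 1) → ℝ) i) : ℂ) -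
              (Circle.exp ((Fin.snoc (Z (φ (χ a))) (-∑ k, Z (φ (χ a)) k) : Fin (n + 1) → ℝ) k) : ℂ)‖) /
                (Fintype.card (Fin (n + 1))).factorial) := by
    intro a ha
    rw [hJD'reg _ (hinjB a ha)]
    exact hJchart a ha
  have key : HasJacobian (haarProbability (Matrix.specialUnitaryGroup (Fin (n + 1)) ℂ)) h' J' :=
    hasJacobian_spectralKernel_sun_booked_boxFlow hE hP hφ hZ hf'm (perm_wallId hf'reg hf'wall hfperm) hχ hχbox hfG'
      (hagree_wallId hf'reg hf'wall hagree hh'reg hh'wall) (norm_wallId hf'reg hf'wall hf1)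
      (prod_wallId hf'reg hf'wall hfdet) hJD'm (perm_wallId_datum hJD'reg hJD'wall hJDperm) hJchart'
      (spec_wallId_datum hJD'reg hJD'wall hJspec hJ'reg hJ'wall)
  -- back to the shipped `h`, `J`: they agree with the primed ones off the (Haar-null) walls
  exact key.congr_ae_map (ae_eq_of_eqOn_separable fun W hW => (hh'reg W hW).symm)
    (ae_eq_of_eqOn_separable fun W hW => (hJ'reg W hW).symm) hhm hJm

end Shipped

end Summit.Ventures.LatticeQCDFlow.Exactness
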